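/-
Copyright: cell pub-balaban-gaps (YM BLITZ Y1, track G1), seat g1-p2 GEN 5 (unit `pub-balaban-gaps-g1-p2`).  Row (D4) NODE O,
OBJECT ∕ MECHANISM level: the DECAYING block letter — block twin of lit `B13DomainKernelWalksDecay` (rung R5c, g1-plan-1 GEN 12
skeleton #8, filed by g1-p2 GEN 4): domain-localised one-step operator families whose BLOCKS decay along the one-point distance,
`‖F_b(u)‖_{y,y′} ≤ λ·e^{−ρD_b(y,y′)}` (print's (3.42) ∕ (3.89): the local inverses and steps decay at the Combes–Thomas rate INSIDE
their domains), are block walk expansions with amplitude `λe^{κ₁m_J}` — NO `e^{2ρr}` (the flat letter's price, plan-1 J33-2) — so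
the walk rate is the operator's OWN decay rate, not one bought from the smallness letter.  With `D4WalkBlockReroute` (through once
per walk) and `D4WalkBlockDecorate` (decorate once per parameter) this is the third piece of print's one-scale walk bookkeeping.
HONEST FRAMING: bookkeeping over a hypothesis shape; nothing of Bałaban's constructed; (D4) NOT discharged (instance 0∕1); NOT
BetaPertH, NOT continuum, NOT Clay.
-/
import Summits.QuantumFields.BalabanUV.Gaps.D4WalkBlockLocal
import Literature.MathematicalPhysics.QuantumFieldTheory.Balaban1983to89.B13DomainKernelWalksDecay

/-!
# `Gaps.D4WalkBlockLocalDecay` — domain-localised families with DECAYING block letters are block walk expansions, amplitude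
`λe^{κ₁m_J}` (cell pub-balaban-gaps, seat g1-p2 gen 5)

HONEST DEPENDENCY (cell pub-balaban, verbatim): continuum YM on T⁴ ⇐ BetaPertH ∧ nine spine estimates (0/9 proved);
BetaPertH ⇐ (D1) ∧ (D4) ∧ CAP+tail.

* `IsDomainLocalBD` — `D4WalkBlockLocal.IsDomainLocalB` with the flat block bound replaced by
  `hbdBD : ‖F_b(u)‖_{y,y′} ≤ λ·e^{−ρ·D_b(y,y′)}` (`D_b` = the one-point distance of `B13DomainKernelWalks`; for untagged terms with
  `y` in the domain `D_b(y,y′) = d₁(y,y′)`-type, i.e. genuine kernel decay).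
* `IsDomainLocalBD.toFlatD` (entries below blocks: an R5c datum of lit `B13DomainKernelWalksDecay`), `.toB` (a flat block datum, `ρ ≥ 0`).
* `blockNorm_term_le_D` — `‖T_b(σ,u)‖_{y,y′} ≤ λe^{κ₁m_J}·e^{−ρD_b(y,y′)}`.
* **`blockWalkExpansion_domainLocalD`** — `BlockWalkExpansion` with amplitudes `λe^{κ₁m_J}`, rate `ρ` = the letter's own rate,
  constant `K̄ = λe^{κ₁m_J}·e^{μr}·n_D·c_μ` (window `κ + μ ≤ ρ − ε`, cube row sum `(μ, c_μ)`), every letter torus-free.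
WHAT IT IS NOT: the decaying letter for Bałaban's `h_□G′_□h_□`, `K(h_□)G′_□h_□` ((3.42) ∕ Cor 3.6 at the Combes–Thomas rate,
k-uniformly) is NOT proved; (D4) instance 0∕1; words UNCHANGED.
-/

noncomputable section

namespace Summit.QuantumFields.BalabanUV.Gaps.D4WalkBlockLocalDecay

open Metric Set Finset
open Literature.MathematicalPhysics.QuantumFieldTheory.Balaban1983to89
open Literature.MathematicalPhysics.QuantumFieldTheory.Balaban1983to89.B9SectDWalk (Through MajSumLe DomBy)
open Literature.MathematicalPhysics.QuantumFieldTheory.Balaban1983to89.B9Thm34Ext (toB6)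
open Literature.MathematicalPhysics.QuantumFieldTheory.Balaban1983to89.B9Thm37GlueTorus (torusGeom tdist1 tdist1_nonneg)
open Literature.MathematicalPhysics.QuantumFieldTheory.Balaban1983to89.TreeLengthTorus (TPt)
open Literature.MathematicalPhysics.QuantumFieldTheory.Balaban1983to89.B5TorusCover (UT)
open Literature.MathematicalPhysics.QuantumFieldTheory.Balaban1983to89.B11SectG (RowSum)
open Literature.MathematicalPhysics.QuantumFieldTheory.Balaban1983to89.B13DomainKernelWalks (DomainTerms)
open Literature.MathematicalPhysics.QuantumFieldTheory.Balaban1983to89.B13DomainKernelWalksDecay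
  (IsDomainLocalD jointWalkExpansion_domainLocalD)
open Summit.QuantumFields.BalabanUV.Gaps.D4WalkBlock
  (blockNorm blockNorm_nonneg blockNorm_smul_le norm_entry_le_blockNorm BlockWalkExpansion)
open Summit.QuantumFields.BalabanUV.Gaps.D4WalkBlockLocal (IsDomainLocalB)

variable {d N' : ℕ} {ν : ℕ} {K : Fin ν → ℕ} [∀ i, NeZero (K i)]
variable {p n : Type} [Fintype p] [Fintype n]
variable {E : Type*} [NormedAddCommGroup E] [NormedSpace ℂ E]

/-- **DOMAIN LOCALITY IN BLOCK CURRENCY WITH DECAYING BLOCKS** (Prop-valued hypothesis shape): `IsDomainLocalB` with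
`hbdBD : ‖F_b(u)‖_{y,y′} ≤ λ·e^{−ρ·D_b(y,y′)}` in place of the flat block bound. [cite: Balaban1985BackgroundPropagators, (3.42) p.399, (3.89) p.409, Thm 3.10 (3.108) p.416; Balaban1988RG2Cluster, (1.11) p.5, p.13, p.15] -/
structure IsDomainLocalBD (L : DomainTerms d N' ν K p n E) (c : B13.Consts) (cub : p → UT K) (cubn : n → UT K)
    (X : Finset (UT K)) (R lam ρ r : ℝ) (mJ nD : ℕ) : Prop where
  hanchor : ∀ b, L.anchor b ∈ L.dom b
  hsuppB : ∀ b u y y', blockNorm cub cubn (L.op b u) y y' ≠ 0 → y ∈ L.dom b ∧ y' ∈ L.dom b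
  han : ∀ b i j, DifferentiableOn ℂ (fun u => L.op b u i j) (ball (0 : E) R)
  hbdBD : ∀ b, ∀ u ∈ ball (0 : E) R, ∀ y y', blockNorm cub cubn (L.op b u) y y' ≤ lam * Real.exp (-(ρ * L.dist X b y y'))
  hdiam : ∀ b, ∀ z ∈ L.dom b, ∀ z' ∈ L.dom b, tdist1 K z z' ≤ r
  hJ : ∀ b, (L.J b).card ≤ mJ
  hX : ∀ b, (L.J b).Nonempty → (L.dom b ∩ X).Nonempty
  hmult : ∀ z : UT K, (Finset.univ.filter fun b => L.anchor b = z).card ≤ nD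

variable {L : DomainTerms d N' ν K p n E}
variable {c : B13.Consts} {cub : p → UT K} {cubn : n → UT K} {X : Finset (UT K)} {R lam ρ r : ℝ} {mJ nD : ℕ}

/-- Entries are below blocks: a decaying block datum is an R5c entrywise-decaying datum for the cube locators.
[cite: Balaban1985BackgroundPropagators, (3.108) p.416] -/
theorem IsDomainLocalBD.toFlatD (hL : IsDomainLocalBD L c cub cubn X R lam ρ r mJ nD) :
    IsDomainLocalD L c cub cubn X R lam ρ r mJ nD where
  hanchor := hL.hanchor
  hsupp b u i j h := hL.hsuppB b u (cub i) (cubn j) fun h0 =>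
    h (norm_eq_zero.1 (le_antisymm ((norm_entry_le_blockNorm cub cubn (L.op b u) i j).trans h0.le) (norm_nonneg _)))
  han := hL.han
  hbdD b u hu i j := (norm_entry_le_blockNorm cub cubn (L.op b u) i j).trans (hL.hbdBD b u hu (cub i) (cubn j))
  hdiam := hL.hdiam
  hJ := hL.hJ
  hX := hL.hX
  hmult := hL.hmult

/-- A decaying block datum is a flat block datum with the same `λ` (`ρ ≥ 0`, `λ ≥ 0`). [cite: Balaban1985BackgroundPropagators, (3.89) p.409] -/
theorem IsDomainLocalBD.toB (hL : IsDomainLocalBD L c cub cubn X R lam ρ r mJ nD) (hρ : 0 ≤ ρ) (hlam : 0 ≤ lam) :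
    IsDomainLocalB L c cub cubn X R lam r mJ nD where
  hanchor := hL.hanchor
  hsuppB := hL.hsuppB
  han := hL.han
  hbdB b u hu y y' := by
    refine (hL.hbdBD b u hu y y').trans ?_
    have h1 : Real.exp (-(ρ * L.dist X b y y')) ≤ 1 :=
      Real.exp_le_one_iff.2 (by have := L.dist_nonneg X b y y'; nlinarith)
    calc lam * Real.exp (-(ρ * L.dist X b y y')) ≤ lam * 1 := mul_le_mul_of_nonneg_left h1 hlam
      _ = lam := mul_one _
  hdiam := hL.hdiam
  hJ := hL.hJ
  hX := hL.hX
  hmult := hL.hmult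

/-- **THE PER-TERM BLOCK BOUND, decaying letter**: `‖T_b(σ,u)‖_{y,y′} ≤ λe^{κ₁m_J}·e^{−ρD_b(y,y′)}` — NO `e^{2ρr}`.
[cite: Balaban1985BackgroundPropagators, (3.108) p.416; Balaban1988RG2Cluster, (1.11) p.5] -/
theorem blockNorm_term_le_D (hL : IsDomainLocalBD L c cub cubn X R lam ρ r mJ nD) (hκ₁ : 0 ≤ c.κ₁)
    (b : L.B) (σ : TPt d N' → ℂ) (hσ : ∀ j, ‖σ j‖ ≤ Real.exp c.κ₁) (u : E) (hu : u ∈ ball (0 : E) R) (y y' : UT K) :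
    blockNorm cub cubn (L.term b σ u) y y' ≤ (lam * Real.exp (c.κ₁ * mJ)) * Real.exp (-(ρ * L.dist X b y y')) := by
  have hT : L.term b σ u = (∏ j ∈ L.J b, σ j) • L.op b u := rfl
  have h1 := DomainTerms.norm_monomial_le hκ₁ (hL.hJ b) σ hσ
  have h2 := hL.hbdBD b u hu y y'
  calc blockNorm cub cubn (L.term b σ u) y y' ≤ ‖∏ j ∈ L.J b, σ j‖ * blockNorm cub cubn (L.op b u) y y' := by
        rw [hT]; exact blockNorm_smul_le cub cubn _ _ y y'
    _ ≤ Real.exp (c.κ₁ * mJ) * (lam * Real.exp (-(ρ * L.dist X b y y'))) :=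
        mul_le_mul h1 h2 (blockNorm_nonneg _ _ _ _ _) (Real.exp_nonneg _)
    _ = (lam * Real.exp (c.κ₁ * mJ)) * Real.exp (-(ρ * L.dist X b y y')) := by ring

/-- **DOMAIN-LOCALISED FAMILIES WITH DECAYING BLOCK LETTERS ARE BLOCK WALK EXPANSIONS, amplitude `λe^{κ₁m_J}`**: `λ, κ₁, ρ ≥ 0`,
drop `ε`, `κ, μ ≥ 0` with `κ + μ ≤ ρ − ε`, cube row sum at rate `μ` (constant `c_μ`) ⟹ `BlockWalkExpansion` at the letter's OWN
rate `ρ` with constant `K̄ = λe^{κ₁m_J}·e^{μr}·n_D·c_μ`, one-point distances through `X_b ∩ X`; σ-structure, analyticity and partial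
sums are lit `jointWalkExpansion_domainLocalD`'s by `toFlatD`. [cite: Balaban1985BackgroundPropagators, Thm 3.10 (3.107)–(3.108) p.416, (3.42) p.399, (3.89) p.409; Balaban1988RG2Cluster, (1.11) p.5, p.13, p.15; Balaban1984PropagatorsII, (2.61) p.234] -/
theorem blockWalkExpansion_domainLocalD (hL : IsDomainLocalBD L c cub cubn X R lam ρ r mJ nD) (hκ₁ : 0 ≤ c.κ₁) (hlam : 0 ≤ lam)
    {ε κ μ cμ : ℝ} (hρ : 0 ≤ ρ) (hκ : 0 ≤ κ) (hμ : 0 ≤ μ) (hwin : κ + μ ≤ ρ - ε)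
    (hrow : RowSum (toB6 (torusGeom K 0 0 0) 0 True) μ cμ) :
    BlockWalkExpansion c cub cubn L.kernel X R ε κ
      ((lam * Real.exp (c.κ₁ * mJ)) * Real.exp (μ * r) * (nD * cμ))
      L.term L.sigmaCarrying (fun _ => lam * Real.exp (c.κ₁ * mJ)) (L.dist X) ρ := by
  have hJ := jointWalkExpansion_domainLocalD hL.toFlatD hκ₁ hlam hρ hκ hμ hwin hrow
  exact
  { hasSum := hJ.hasSum
    termAnalytic := hJ.termAnalytic
    majB := fun b σ hσ u hu y y' => blockNorm_term_le_D hL hκ₁ b σ hσ u hu y y'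
    majSum := hJ.majSum
    indep := hJ.indep
    through := hJ.through
    A_nonneg := hJ.A_nonneg
    D_nonneg := hJ.D_nonneg }

end Summit.QuantumFields.BalabanUV.Gaps.D4WalkBlockLocalDecay

end
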